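import Summits.Ventures.CertifiedArithmetic.LowPrec.GemmEnvelopeRowsPipeline
import Summits.Ventures.CertifiedArithmetic.LowPrec.GemmEnvelopeRowsB

/-!
# GEMM-level envelopes, part (s): row P4 (functional F2) under the accumulation and output models (pub-lowprec gemm gen 22, LXX-s)

HONEST FRAMING: certified error envelopes and provably optimal rounding/accumulation schemes for
low-precision formats under stated cost models; every table by two implementations; no hardware or
vendor claims.

Row P4 compares MX-E4M3-ceil with the per-vector datapaths on ALL inputs under the functional F2 (error
relative to `K · Aa · Ab`, the tensor of numerators): the per-vector datapaths obey uniform F2 bounds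
(`57/784` for E4M3, `509/64516` for INT8, part (e)), the MX all-`272` input has F2 error `33/289`.  The relative
bracket of part (n) does not apply here (per-element relative errors are unbounded on all inputs), so this file
gives the ABSOLUTE bracket and decides the row at the GEMM output:
* `pipeline_le_abs` — if `ΣΣ |q̂a q̂b| ≤ T`, the quantisation error is `≤ e`, `|acc - ΣΣ q̂a q̂b| ≤ γ ΣΣ |q̂a q̂b|`
  and `|c - acc| ≤ δ |acc|`, then `|c - ΣΣ a b| ≤ e + (γ + δ(1+γ))·T`;
* `row_P4_F2_vecE4M3_pipelines` / `row_P4_F2_int8_pipelines` — with `γ ≤ 1/2048`, `δ ≤ 1/257` the per-vector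
  full-pipeline F2 errors are `≤ C₄ = 57/784 + Γ₀·(29/28)²` resp. `≤ C₈ = 509/64516 + Γ₀·(255/254)²`,
  `Γ₀ = 1/2048 + (1/257)(1 + 1/2048)` (`C₄ ≈ 0.07741`, `C₈ ≈ 0.01231`);
* `row_P4_mx_fails_pipelines` — the MX all-`272` input (`272 ↦ 256`, a shortfall) has full F2 error `> C₄`
  (hence `> C₈`) for EVERY realisation (`pipeline_witness_down`: `65536·(2049/2048)(258/257) + C₄·73984 < 73984`).
So row P4 («`MXC ≼ VEC-E4M3` and `MXC ≼ INT8` FAIL under F2») holds at the GEMM output with Binary32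
accumulation (`K ≤ 8193` / `k + B ≤ 8193`) and BFloat16-or-finer output. [cite: Higham2002ASNA, §3.1];
[cite: RouhaniEtAl2023MX, §5.1]
-/

namespace Summit.Ventures.CertifiedArithmetic.LowPrec.GemmEnvelope

open Finset
open Literature.ComputerArithmetic.FloatingPoint
open Literature.ComputerArithmetic.FloatingPoint.Format
open Literature.ComputerArithmetic.FloatingPoint.MiniFloat
open Literature.ComputerArithmetic.FloatingPoint.MXBlock
open Summit.Ventures.CertifiedArithmetic.LowPrec.SR

/-- ABSOLUTE PIPELINE BRACKET: quantisation error `≤ e`, quantised products of total magnitude `≤ T`,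
accumulation `γ`-accurate relative to that magnitude, output `δ`-accurate relative to `|acc|` ⇒ full error
`≤ e + (γ + δ(1+γ))·T`. [cite: Higham2002ASNA, §3.1] -/
theorem pipeline_le_abs {B k : ℕ} (a b qa qb : Fin B → Fin k → ℚ) {γ δ acc c e T : ℚ}
    (hγ : 0 ≤ γ) (hδ : 0 ≤ δ)
    (hT : ∑ j, ∑ i, |qa j i * qb j i| ≤ T)
    (he : |∑ j, ∑ i, qa j i * qb j i - ∑ j, ∑ i, a j i * b j i| ≤ e)
    (hacc : |acc - ∑ j, ∑ i, qa j i * qb j i| ≤ γ * ∑ j, ∑ i, |qa j i * qb j i|)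
    (hc : |c - acc| ≤ δ * |acc|) :
    |c - ∑ j, ∑ i, a j i * b j i| ≤ e + (γ + δ * (1 + γ)) * T := by
  set Sq := ∑ j, ∑ i, qa j i * qb j i with hSq
  set T' := ∑ j, ∑ i, |qa j i * qb j i| with hT'
  set S := ∑ j, ∑ i, a j i * b j i with hS
  have hSqT : |Sq| ≤ T' :=
    le_trans (abs_sum_le_sum_abs _ _) (sum_le_sum fun j _ => abs_sum_le_sum_abs _ _)
  have hT'0 : 0 ≤ T' := le_trans (abs_nonneg _) hSqT
  have hacc' : |acc| ≤ (1 + γ) * T' := by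
    have h1 : |acc| ≤ |Sq| + |acc - Sq| := by
      have := abs_add_le Sq (acc - Sq); rwa [add_sub_cancel] at this
    linarith
  have h1 : |c - S| ≤ |c - acc| + |acc - Sq| + |Sq - S| := by
    have e1 : c - S = (c - acc) + (acc - Sq) + (Sq - S) := by ring
    rw [e1]
    exact le_trans (abs_add_le _ _) (by linarith [abs_add_le (c - acc) (acc - Sq)])
  have h2 : δ * |acc| ≤ δ * ((1 + γ) * T') := mul_le_mul_of_nonneg_left hacc' hδ
  have h3 : (γ + δ * (1 + γ)) * T' ≤ (γ + δ * (1 + γ)) * T := mul_le_mul_of_nonneg_left hT (by positivity)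
  nlinarith

/-- **ROW P4, per-vector E4M3 at the GEMM output**: on ALL inputs (`|a| ≤ Aa`, `|b| ≤ Ab`, numerators `Aa, Ab > 0`),
with accumulation `γ ≤ 1/2048` and output `δ ≤ 1/257`, the full-pipeline error is
`≤ (57/784 + (1/2048 + (1/257)(1 + 1/2048))·(841/784)) · K·Aa·Ab`. [cite: Higham2002ASNA, §3.1] -/
theorem row_P4_F2_vecE4M3_pipelines {B k : ℕ} (a b : Fin B → Fin k → ℚ) {Aa Ab γ δ acc c : ℚ}
    (hAa : 0 < Aa) (hAb : 0 < Ab) (ha : ∀ j i, |a j i| ≤ Aa) (hb : ∀ j i, |b j i| ≤ Ab)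
    (hγ0 : 0 ≤ γ) (hγ : γ ≤ 1 / 2048) (hδ0 : 0 ≤ δ) (hδ : δ ≤ 1 / 257)
    (hacc : |acc - ∑ j, ∑ i, (Aa / E4M3.maxRat * (roundNE E4M3 (a j i / (Aa / E4M3.maxRat))).toRat) *
        (Ab / E4M3.maxRat * (roundNE E4M3 (b j i / (Ab / E4M3.maxRat))).toRat)|
      ≤ γ * ∑ j, ∑ i, |(Aa / E4M3.maxRat * (roundNE E4M3 (a j i / (Aa / E4M3.maxRat))).toRat) *
        (Ab / E4M3.maxRat * (roundNE E4M3 (b j i / (Ab / E4M3.maxRat))).toRat)|)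
    (hc : |c - acc| ≤ δ * |acc|) :
    |c - ∑ j, ∑ i, a j i * b j i|
      ≤ (57 / 784 + (1 / 2048 + 1 / 257 * (1 + 1 / 2048)) * (841 / 784)) * (((B * k : ℕ) : ℚ) * (Aa * Ab)) := by
  set qa : Fin B → Fin k → ℚ := fun j i =>
    Aa / E4M3.maxRat * (roundNE E4M3 (a j i / (Aa / E4M3.maxRat))).toRat with hqa
  set qb : Fin B → Fin k → ℚ := fun j i =>
    Ab / E4M3.maxRat * (roundNE E4M3 (b j i / (Ab / E4M3.maxRat))).toRat with hqb
  have hea : ∀ j i, |qa j i - a j i| ≤ Aa / 28 := fun j i => vec_abs_error_le_E4M3 (ha j i) hAa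
  have heb : ∀ j i, |qb j i - b j i| ≤ Ab / 28 := fun j i => vec_abs_error_le_E4M3 (hb j i) hAb
  have he : |∑ j, ∑ i, qa j i * qb j i - ∑ j, ∑ i, a j i * b j i| ≤ 57 / 784 * (((B * k : ℕ) : ℚ) * (Aa * Ab)) := by
    have h := abs_sum_mul_sub_sum_mul_le_abs_unif (ι := Fin B × Fin k)
      (a := fun p => a p.1 p.2) (b := fun p => b p.1 p.2) (qa := fun p => qa p.1 p.2) (qb := fun p => qb p.1 p.2)
      (ea := Aa / 28) (eb := Ab / 28) (A := Aa) (B' := Ab) (by positivity)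
      (fun p => hea p.1 p.2) (fun p => heb p.1 p.2) (fun p => ha p.1 p.2) (fun p => hb p.1 p.2)
    simp only [Fintype.sum_prod_type, Fintype.card_prod, Fintype.card_fin] at h
    refine le_trans h (le_of_eq ?_)
    push_cast; ring
  have hma : ∀ j i, |qa j i| ≤ Aa * (29 / 28) := fun j i => by
    have h1 := hea j i
    have h2 : |qa j i| ≤ |a j i| + |qa j i - a j i| := by
      have := abs_add_le (a j i) (qa j i - a j i); rwa [add_sub_cancel] at this
    linarith [ha j i]
  have hmb : ∀ j i, |qb j i| ≤ Ab * (29 / 28) := fun j i => by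
    have h1 := heb j i
    have h2 : |qb j i| ≤ |b j i| + |qb j i - b j i| := by
      have := abs_add_le (b j i) (qb j i - b j i); rwa [add_sub_cancel] at this
    linarith [hb j i]
  have hT : ∑ j, ∑ i, |qa j i * qb j i| ≤ ((B * k : ℕ) : ℚ) * (Aa * (29 / 28) * (Ab * (29 / 28))) := by
    calc ∑ j, ∑ i, |qa j i * qb j i| ≤ ∑ _j : Fin B, ∑ _i : Fin k, Aa * (29 / 28) * (Ab * (29 / 28)) :=
          sum_le_sum fun j _ => sum_le_sum fun i _ => by
            rw [abs_mul]; exact mul_le_mul (hma j i) (hmb j i) (abs_nonneg _) (by positivity)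
      _ = ((B * k : ℕ) : ℚ) * (Aa * (29 / 28) * (Ab * (29 / 28))) := by
          simp only [sum_const, card_univ, Fintype.card_fin, nsmul_eq_mul]; push_cast; ring
  have h := pipeline_le_abs a b qa qb hγ0 hδ0 hT he hacc hc
  have hK : (0 : ℚ) ≤ ((B * k : ℕ) : ℚ) * (Aa * Ab) := by positivity
  have hG : γ + δ * (1 + γ) ≤ 1 / 2048 + 1 / 257 * (1 + 1 / 2048) := by
    have := mul_le_mul hδ hγ hγ0 (by norm_num : (0 : ℚ) ≤ 1 / 257); linarith
  have hG0 : 0 ≤ γ + δ * (1 + γ) := by positivity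
  have h3 : (γ + δ * (1 + γ)) * (((B * k : ℕ) : ℚ) * (Aa * (29 / 28) * (Ab * (29 / 28))))
      ≤ (1 / 2048 + 1 / 257 * (1 + 1 / 2048)) * (841 / 784) * (((B * k : ℕ) : ℚ) * (Aa * Ab)) := by
    have e1 : (γ + δ * (1 + γ)) * (((B * k : ℕ) : ℚ) * (Aa * (29 / 28) * (Ab * (29 / 28))))
        = (γ + δ * (1 + γ)) * (841 / 784) * (((B * k : ℕ) : ℚ) * (Aa * Ab)) := by ring
    rw [e1]
    exact mul_le_mul_of_nonneg_right (by linarith) hK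
  linarith

/-- **ROW P4, per-vector INT8 at the GEMM output**: on ALL inputs, with `γ ≤ 1/2048`, `δ ≤ 1/257`, the
full-pipeline error is `≤ (509/64516 + (1/2048 + (1/257)(1 + 1/2048))·(65025/64516)) · K·Aa·Ab`.
[cite: Higham2002ASNA, §3.1] -/
theorem row_P4_F2_int8_pipelines {B k : ℕ} (a b : Fin B → Fin k → ℚ) {Aa Ab γ δ acc c : ℚ}
    (hAa : 0 < Aa) (hAb : 0 < Ab) (ha : ∀ j i, |a j i| ≤ Aa) (hb : ∀ j i, |b j i| ≤ Ab)
    (hγ0 : 0 ≤ γ) (hγ : γ ≤ 1 / 2048) (hδ0 : 0 ≤ δ) (hδ : δ ≤ 1 / 257)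
    (hacc : |acc - ∑ j, ∑ i, (Aa / 127 * (round (a j i / (Aa / 127)) : ℚ)) *
        (Ab / 127 * (round (b j i / (Ab / 127)) : ℚ))|
      ≤ γ * ∑ j, ∑ i, |(Aa / 127 * (round (a j i / (Aa / 127)) : ℚ)) *
        (Ab / 127 * (round (b j i / (Ab / 127)) : ℚ))|)
    (hc : |c - acc| ≤ δ * |acc|) :
    |c - ∑ j, ∑ i, a j i * b j i|
      ≤ (509 / 64516 + (1 / 2048 + 1 / 257 * (1 + 1 / 2048)) * (65025 / 64516)) * (((B * k : ℕ) : ℚ) * (Aa * Ab)) := by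
  set qa : Fin B → Fin k → ℚ := fun j i => Aa / 127 * (round (a j i / (Aa / 127)) : ℚ) with hqa
  set qb : Fin B → Fin k → ℚ := fun j i => Ab / 127 * (round (b j i / (Ab / 127)) : ℚ) with hqb
  have hea : ∀ j i, |qa j i - a j i| ≤ Aa / 254 := fun j i =>
    le_trans (intQ_abs_error_le (by positivity) (a j i)) (by apply le_of_eq; ring)
  have heb : ∀ j i, |qb j i - b j i| ≤ Ab / 254 := fun j i =>
    le_trans (intQ_abs_error_le (by positivity) (b j i)) (by apply le_of_eq; ring)
  have he : |∑ j, ∑ i, qa j i * qb j i - ∑ j, ∑ i, a j i * b j i|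
      ≤ 509 / 64516 * (((B * k : ℕ) : ℚ) * (Aa * Ab)) := by
    have h := abs_sum_mul_sub_sum_mul_le_abs_unif (ι := Fin B × Fin k)
      (a := fun p => a p.1 p.2) (b := fun p => b p.1 p.2) (qa := fun p => qa p.1 p.2) (qb := fun p => qb p.1 p.2)
      (ea := Aa / 254) (eb := Ab / 254) (A := Aa) (B' := Ab) (by positivity)
      (fun p => hea p.1 p.2) (fun p => heb p.1 p.2) (fun p => ha p.1 p.2) (fun p => hb p.1 p.2)
    simp only [Fintype.sum_prod_type, Fintype.card_prod, Fintype.card_fin] at h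
    refine le_trans h (le_of_eq ?_)
    push_cast; ring
  have hma : ∀ j i, |qa j i| ≤ Aa * (255 / 254) := fun j i => by
    have h1 := hea j i
    have h2 : |qa j i| ≤ |a j i| + |qa j i - a j i| := by
      have := abs_add_le (a j i) (qa j i - a j i); rwa [add_sub_cancel] at this
    linarith [ha j i]
  have hmb : ∀ j i, |qb j i| ≤ Ab * (255 / 254) := fun j i => by
    have h1 := heb j i
    have h2 : |qb j i| ≤ |b j i| + |qb j i - b j i| := by
      have := abs_add_le (b j i) (qb j i - b j i); rwa [add_sub_cancel] at this
    linarith [hb j i]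
  have hT : ∑ j, ∑ i, |qa j i * qb j i| ≤ ((B * k : ℕ) : ℚ) * (Aa * (255 / 254) * (Ab * (255 / 254))) := by
    calc ∑ j, ∑ i, |qa j i * qb j i| ≤ ∑ _j : Fin B, ∑ _i : Fin k, Aa * (255 / 254) * (Ab * (255 / 254)) :=
          sum_le_sum fun j _ => sum_le_sum fun i _ => by
            rw [abs_mul]; exact mul_le_mul (hma j i) (hmb j i) (abs_nonneg _) (by positivity)
      _ = ((B * k : ℕ) : ℚ) * (Aa * (255 / 254) * (Ab * (255 / 254))) := by
          simp only [sum_const, card_univ, Fintype.card_fin, nsmul_eq_mul]; push_cast; ring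
  have h := pipeline_le_abs a b qa qb hγ0 hδ0 hT he hacc hc
  have hK : (0 : ℚ) ≤ ((B * k : ℕ) : ℚ) * (Aa * Ab) := by positivity
  have hG : γ + δ * (1 + γ) ≤ 1 / 2048 + 1 / 257 * (1 + 1 / 2048) := by
    have := mul_le_mul hδ hγ hγ0 (by norm_num : (0 : ℚ) ≤ 1 / 257); linarith
  have hG0 : 0 ≤ γ + δ * (1 + γ) := by positivity
  have h3 : (γ + δ * (1 + γ)) * (((B * k : ℕ) : ℚ) * (Aa * (255 / 254) * (Ab * (255 / 254))))
      ≤ (1 / 2048 + 1 / 257 * (1 + 1 / 2048)) * (65025 / 64516) * (((B * k : ℕ) : ℚ) * (Aa * Ab)) := by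
    have e1 : (γ + δ * (1 + γ)) * (((B * k : ℕ) : ℚ) * (Aa * (255 / 254) * (Ab * (255 / 254))))
        = (γ + δ * (1 + γ)) * (65025 / 64516) * (((B * k : ℕ) : ℚ) * (Aa * Ab)) := by ring
    rw [e1]
    exact mul_le_mul_of_nonneg_right (by linarith) hK
  linarith

/-- **ROW P4, the MX witness at the GEMM output**: the MX-E4M3-ceil all-`272` input (numerators `272`; `272 ↦ 256`)
has full-pipeline F2 error `> C₄ = 57/784 + Γ₀·(841/784)` (`> C₈`, the INT8 constant, a fortiori) for EVERY
realisation of accumulation `γ ≤ 1/2048` and output `δ ≤ 1/257`: row P4 holds at the GEMM output.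
[cite: RouhaniEtAl2023MX, §5.1] -/
theorem row_P4_mx_fails_pipelines {B k : ℕ} (hB : 0 < B) (hk : 0 < k) {γ δ : ℚ}
    (hγ : γ ≤ 1 / 2048) (hδ : δ ≤ 1 / 257) :
    ∃ (a b : Fin B → Fin k → ℚ) (Aa Ab : ℚ), 0 < Aa ∧ 0 < Ab ∧
      (∀ j i, |a j i| ≤ Aa) ∧ (∀ j i, |b j i| ≤ Ab) ∧
      ∀ acc c : ℚ,
        |acc - ∑ j, ∑ i, (ceilScale E4M3 (a j) * (roundNE E4M3 (a j i / ceilScale E4M3 (a j))).toRat) *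
            (ceilScale E4M3 (b j) * (roundNE E4M3 (b j i / ceilScale E4M3 (b j))).toRat)|
          ≤ γ * ∑ j, ∑ i, |(ceilScale E4M3 (a j) * (roundNE E4M3 (a j i / ceilScale E4M3 (a j))).toRat) *
            (ceilScale E4M3 (b j) * (roundNE E4M3 (b j i / ceilScale E4M3 (b j))).toRat)| →
        |c - acc| ≤ δ * |acc| →
        (57 / 784 + (1 / 2048 + 1 / 257 * (1 + 1 / 2048)) * (841 / 784)) * (((B * k : ℕ) : ℚ) * (Aa * Ab))
          < |c - ∑ j, ∑ i, a j i * b j i| := by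
  obtain ⟨n, rfl⟩ : ∃ n, k = n + 1 := ⟨k - 1, by omega⟩
  have hmem : ∀ (j : Fin B) (i : Fin (n + 1)), |(fun (_ : Fin B) (_ : Fin (n + 1)) => (272 : ℚ)) j i| ≤ 272 :=
    fun _ _ => by rw [abs_of_pos (by norm_num)]
  refine ⟨fun _ _ => 272, fun _ _ => 272, 272, 272, by norm_num, by norm_num, hmem, hmem, fun acc c hacc hc => ?_⟩
  have h256 : ceilScale E4M3 (fun _ : Fin (n + 1) => (272 : ℚ)) *
      (roundNE E4M3 (272 / ceilScale E4M3 (fun _ : Fin (n + 1) => (272 : ℚ)))).toRat = 256 := by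
    have h := mxCeil_const_272 n (0 : Fin (n + 1)); beta_reduce at h; exact h
  simp only [h256, sum_const, card_univ, Fintype.card_fin, nsmul_eq_mul] at hacc ⊢
  have hN : (0 : ℚ) < (B : ℚ) * ((n + 1 : ℕ) : ℚ) := by
    have : (0 : ℚ) < (B : ℚ) := by exact_mod_cast hB
    positivity
  have e1 : ((B : ℚ) * (((n + 1 : ℕ) : ℚ) * (256 * 256)) : ℚ) = (B : ℚ) * ((n + 1 : ℕ) : ℚ) * (256 * 256) := by
    ring
  have e2 : ((B : ℚ) * (((n + 1 : ℕ) : ℚ) * |(256 : ℚ) * 256|) : ℚ) = (B : ℚ) * ((n + 1 : ℕ) : ℚ) * |(256 : ℚ) * 256| := by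
    ring
  have e3 : ((B : ℚ) * (((n + 1 : ℕ) : ℚ) * (272 * 272)) : ℚ) = (B : ℚ) * ((n + 1 : ℕ) : ℚ) * (272 * 272) := by
    ring
  have e4 : (((B * (n + 1) : ℕ) : ℚ) * (272 * 272) : ℚ) = (B : ℚ) * ((n + 1 : ℕ) : ℚ) * |(272 : ℚ) * 272| := by
    rw [abs_of_pos (by norm_num : (0 : ℚ) < 272 * 272)]; push_cast; ring
  rw [e1, e2] at hacc
  rw [e3, e4, ← mul_assoc]
  have h := pipeline_witness_down (C := 57 / 784 + (1 / 2048 + 1 / 257 * (1 + 1 / 2048)) * (841 / 784))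
    hN (by norm_num : (0 : ℚ) < 256 * 256) (by norm_num : (0 : ℚ) < 272 * 272) hγ hδ hacc hc (by norm_num)
  linarith

end Summit.Ventures.CertifiedArithmetic.LowPrec.GemmEnvelope
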